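import Literature.NumberTheory.Automorphic.PairLFunctionMeromorphicContinuationNeConjProofs
import Literature.NumberTheory.Automorphic.PairLFunctionPolesGLOneRatProofs
import HarnessLib

/-!
# Mœglin–Waldspurger, Corollaire (i)(b) for `GL_1` over `ℚ`, unconditionally: the conductor of a
finite-order Hecke character of `ℚ` and the entireness of its partial `L`-functions

Topic `NumberTheory/Automorphic`; namespace `Literature.NumberTheory.Automorphic` (with the `GL_1/ℚ`
dictionary lemmas in `Literature.NumberTheory.GaloisRepresentations`, next to
`HeckeCharacter.ofDirichlet` which they concern, as in the sibling `PairLFunctionPolesGLOneRatProofs`).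
Proof file (theorems only: no definition, no named fact, no instance), continuing
`PairLFunctionMeromorphicContinuationNeConjProofs`, which reduced the rank-one case of the named fact
`MoeglinWaldspurger1989_partialPairL_entire_of_ne_conj` (Mœglin–Waldspurger (1989), Appendice,
Corollaire (i)(b), p. 667) over a number field `K` to: *for every unitary Hecke character `ψ ≠ 1`
of `K` trivial on `A_G` and every finite `S` off which `ψ` is unramified, `L^S(s, ψ)` extends to an
entire function* (`…_one_of_heckeCharacter`). Here this is **proved for `K = ℚ`** from Mathlib's
Dirichlet `L`-functions, so that Corollaire (i)(b) holds unconditionally for `GL_1(𝔸_ℚ)`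
(`MoeglinWaldspurger1989_partialPairL_entire_of_ne_conj_one_rat`).

The point, compared with the boundary statement `heckeLandau_rat` of `PairLFunctionPolesGLOneRatProofs`
(which only needed *some* Dirichlet character `d` mod *some* `m` matching `ψ` at the primes
`p ∤ m`, the finitely many Euler factors at unramified `p ∣ m` being continuous and non-zero on
`Re s ≥ 1`), is that entireness of `L^S(s, ψ)` for **every** admissible `S` requires the exact
conductor: an Euler factor `(1 - ψ(ϖ_p) p^{-s})⁻¹` at an unramified `p ∉ S` has poles on `Re s = 0`,
which only the primitive `L(s, d₀)` absorbs. Hence the dictionary is completed first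
(Neukirch, *Algebraic Number Theory*, Ch. VII §6, (6.9)–(6.14); Washington, *Cyclotomic Fields*,
Ch. 3):

* `Rat.equivPi_apply`, `Rat.equivPi_eq_one_of_unitsMap_eq_one`, `Rat.exists_rayClassHom_localUnits_eq`
  — **the ray class map `𝕀_ℚ → (ℤ/f)ˣ` maps the local units `ℤ_pˣ` at `p ∣ f` onto the kernel of
  `(ℤ/f)ˣ → (ℤ/f')ˣ`, `f' = f / p^{v_p(f)}`** (Chinese remainder theorem: the idele `⟨n⟩_p` of an
  integer `n ≡ x (mod f)` reduces to `x` when `x ≡ 1 (mod f')`);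
* `HeckeCharacter.not_isUnramifiedAt_ofDirichlet` — **the Hecke character of a primitive Dirichlet
  character `d₀` of conductor `f` is ramified at every `p ∣ f`** (otherwise `d₀` kills that kernel,
  i.e. factors through `f'`, Mathlib `DirichletCharacter.factorsThrough_iff_ker_unitsMap`,
  contradicting primitivity);
* `HeckeCharacter.ofDirichlet_one`, `HeckeCharacter.exists_eq_ofDirichlet_isPrimitive` — **every
  finite-order Hecke character of `ℚ` is `ofDirichlet d₀` for a primitive `d₀`** (the tree's
  `exists_dirichletCharacter_of_isFiniteOrder_holds` gives `d` mod `m`; `d₀ = d.primitiveCharacter`,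
  and `ψ = ofDirichlet d₀` by the uniqueness half of `HeckeCharacter.exists_of_dirichletCharacter_holds`);
* `exists_entire_eq_partialHeckeL_rat` — for unitary `ψ ≠ 1` trivial on `ℝ_{>0}` (hence of finite
  order) unramified off the finite `S`: all primes of the conductor `f` lie under `S`, so
  `L^S(s, ψ) = L(s, d₀,N)` on `Re s > 1` with `N = f ∏_{v ∈ S} p_v`
  (`tprod_eulerFactor_eq_LSeries_mul_prod` with no exceptional place), and `L(s, d₀,N)` is entire
  for `d₀,N ≠ 1` (Mathlib `DirichletCharacter.differentiable_LFunction`);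
* `MoeglinWaldspurger1989_partialPairL_entire_of_ne_conj_one_rat` (**main**) — the named fact for
  `n = 1`, `K = ℚ`.

## References

* C. Mœglin, J.-L. Waldspurger, *Le spectre résiduel de `GL(n)`*, Ann. Sci. École Norm. Sup. (4)
  22 (1989), Appendice, Corollaire (i)(b), p. 667. [MoeglinWaldspurger1989]
* J. Neukirch, *Algebraic Number Theory*, Grundlehren 322 (1999), Ch. VI §1 (1.9)–(1.10),
  Ch. VII §6 (6.9)–(6.14), §8. [NeukirchANT1999]
-/

noncomputable section

open scoped Topology NNReal
open NumberField IsDedekindDomain MeasureTheory Filter Complex Set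

/-! ### The conductor of a finite-order Hecke character of `ℚ` -/

namespace Literature.NumberTheory.GaloisRepresentations

open Rat.HeightOneSpectrum

section Conductor

/-- The components of the Chinese remainder isomorphism `ℤ/m ≃ ∏_{q^e ‖ m} ℤ/q^e` are the
reductions (uniqueness of ring homomorphisms out of `ℤ/m`). [folklore] -/
theorem Rat.equivPi_apply {m : ℕ} (hm : m ≠ 0) (b : ZMod m) (q : m.primeFactors) :
    ZMod.equivPi (n := m) hm b q =
      ZMod.castHom (Nat.ordProj_dvd m q) (ZMod ((q : ℕ) ^ m.factorization q)) b :=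
  RingHom.congr_fun (Subsingleton.elim
    ((Pi.evalRingHom (fun q : m.primeFactors => ZMod ((q : ℕ) ^ m.factorization q)) q).comp
      (ZMod.equivPi (n := m) hm).toRingHom) (ZMod.castHom _ _)) b

/-- A unit `x ∈ (ℤ/m)ˣ` with trivial image in `(ℤ/m')ˣ`, `m' = m / p^{v_p(m)}`, has component `1`
at every prime factor `q ≠ p` of `m` (`q^{v_q(m)} ∣ m'`). [folklore] -/
theorem Rat.equivPi_eq_one_of_unitsMap_eq_one {m : ℕ} [NeZero m] {p : ℕ} {x : (ZMod m)ˣ}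
    (hx : ZMod.unitsMap (Nat.ordCompl_dvd m p) x = 1) (q : m.primeFactors) (hq : (q : ℕ) ≠ p) :
    ZMod.equivPi (n := m) (NeZero.ne m) (x : ZMod m) q = 1 := by
  have hfac : (ordCompl[p] m).factorization q = m.factorization q := by
    rw [Nat.factorization_ordCompl, Finsupp.erase_ne hq]
  have hdvd : (q : ℕ) ^ m.factorization q ∣ ordCompl[p] m := by
    rw [← hfac]; exact Nat.ordProj_dvd _ _
  have hcast : ZMod.castHom (Nat.ordCompl_dvd m p) (ZMod (ordCompl[p] m)) (x : ZMod m) =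
      ((ZMod.unitsMap (Nat.ordCompl_dvd m p) x : (ZMod (ordCompl[p] m))ˣ) : ZMod (ordCompl[p] m)) :=
    rfl
  rw [Rat.equivPi_apply, ← ZMod.castHom_comp hdvd (Nat.ordCompl_dvd m p), RingHom.comp_apply,
    hcast, hx, Units.val_one, map_one]

/-- The local reduction at `v` of the local idele `⟨n⟩_v` of an integer `n` prime to `p_v` is
`n mod p_v^k` (it has the same `v`-component as the principal idele `(n)`,
`Rat.localRed_principalIdele_natCast`). [folklore] -/
theorem Rat.localRed_localUnits_natCast (v : HeightOneSpectrum (𝓞 ℚ)) (k : ℕ) {n : ℕ}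
    (hn : n.Coprime (natGenerator v)) (hn0 : (n : ℚ) ≠ 0) :
    Rat.localRed v k (localUnits v (globalToLocalUnits v (Units.mk0 (n : ℚ) hn0))) =
      ZMod.unitOfCoprime n (hn.pow_right k) := by
  rw [← Rat.localRed_principalIdele_natCast v k hn hn0]
  exact Rat.localRed_congr v k (by rw [localUnits_snd_apply_self, val_globalToLocalUnits,
    principalIdele_snd])

/-- **The ray class map sends `ℤ_pˣ` onto `ker((ℤ/m)ˣ → (ℤ/m')ˣ)`, `m' = m / p^{v_p(m)}`.** For a
prime factor `p` of `m` (place `v`) and `x ∈ (ℤ/m)ˣ` with `x ≡ 1 (mod m')` there is a unit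
`U ∈ ℤ_pˣ` with `rayClassHom m ⟨U⟩_v = x`: take `U = n` for an integer `n ≡ x (mod m)`; the idele
`⟨n⟩_v` has positive real part and unit components, so its ray class is its reduction, whose Chinese
remainder components are `n ≡ x (mod p^{v_p(m)})` at `p` and `1 ≡ x (mod q^{v_q(m)})` at `q ≠ p`.
Ref: Neukirch, *Algebraic Number Theory*, Ch. VI §1, Prop. (1.9)–(1.10)
(`C_ℚ^{𝔪'}/C_ℚ^{𝔪} ≅ ker((ℤ/m)ˣ → (ℤ/m')ˣ)` generated by `U_p`). [cite: NeukirchANT1999, Ch. VI Prop. (1.10)] -/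
theorem Rat.exists_rayClassHom_localUnits_eq {m : ℕ} [NeZero m] (q₀ : m.primeFactors)
    {x : (ZMod m)ˣ} (hx : ZMod.unitsMap (Nat.ordCompl_dvd m q₀) x = 1) :
    ∃ U : ((Rat.placeOfFactor m q₀).adicCompletion ℚ)ˣ,
      Valued.v (U : (Rat.placeOfFactor m q₀).adicCompletion ℚ) = 1 ∧
        Rat.rayClassHom m (localUnits (Rat.placeOfFactor m q₀) U) = x := by
  set v := Rat.placeOfFactor m q₀ with hv
  have hp : (q₀ : ℕ).Prime := Nat.prime_of_mem_primeFactors q₀.2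
  have hpv : natGenerator v = q₀ := Rat.natGenerator_placeOfFactor m q₀
  have hm1 : 1 < m := lt_of_lt_of_le hp.one_lt
    (Nat.le_of_dvd (NeZero.pos m) (Nat.dvd_of_mem_primeFactors q₀.2))
  set n : ℕ := (x : ZMod m).val with hn
  have hnm : n.Coprime m := ZMod.val_coe_unit_coprime x
  have hnx : (n : ZMod m) = x := ZMod.natCast_zmod_val _
  have hn0' : n ≠ 0 := fun h => by
    rw [h, Nat.coprime_zero_left] at hnm
    exact (ne_of_gt hm1) hnm
  have hn0 : (n : ℚ) ≠ 0 := by exact_mod_cast hn0'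
  have hnp : n.Coprime (natGenerator v) := by
    rw [hpv]; exact hnm.coprime_dvd_right (Nat.dvd_of_mem_primeFactors q₀.2)
  set U : (v.adicCompletion ℚ)ˣ := globalToLocalUnits v (Units.mk0 (n : ℚ) hn0) with hU
  have hU1 : Valued.v (U : v.adicCompletion ℚ) = 1 := by
    rw [hU, val_globalToLocalUnits, valued_algebraMap_adicCompletion, Units.val_mk0,
      ← Int.cast_natCast]
    refine Rat.valuation_intCast_eq_one v ?_
    rw [Int.natCast_dvd_natCast]
    exact (Nat.Prime.coprime_iff_not_dvd (prime_natGenerator v)).1 hnp.symm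
  refine ⟨U, hU1, ?_⟩
  rw [Rat.rayClassHom_eq_redMod m _ (by rw [Rat.infReal_localUnits]; exact one_pos)
    (Rat.valued_localUnits v U hU1)]
  refine Units.ext ((ZMod.equivPi (n := m) (NeZero.ne m)).injective (funext fun q => ?_))
  rw [Rat.equivPi_redMod, Rat.val_localRedFactor]
  by_cases hq : q = q₀
  · subst hq
    rw [Rat.localRed_localUnits_natCast v _ hnp hn0, ZMod.coe_unitOfCoprime, map_natCast, ← hnx,
      Rat.equivPi_apply, map_natCast]
  · have hq' : (q : ℕ) ≠ q₀ := fun h => hq (Subtype.ext h)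
    have hvq : Rat.placeOfFactor m q ≠ v := fun h => hq' (by
      rw [← Rat.natGenerator_placeOfFactor m q, h, hpv])
    rw [Rat.localRed_eq_one_of_snd_eq_one _ _ (localUnits_snd_apply_of_ne U hvq), Units.val_one,
      map_one, Rat.equivPi_eq_one_of_unitsMap_eq_one hx q hq']

/-- **The Hecke character of a primitive Dirichlet character of conductor `f` is ramified at every
`p ∣ f`.** If `ψ_{d₀}` were trivial on `ℤ_pˣ` then, by `Rat.exists_rayClassHom_localUnits_eq`,
`d₀` would kill `ker((ℤ/f)ˣ → (ℤ/f')ˣ)`, `f' = f/p^{v_p(f)} < f`, i.e. factor through `f'` (Mathlib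
`DirichletCharacter.factorsThrough_iff_ker_unitsMap`), so that `f = conductor d₀ ∣ f'`.
Ref: Neukirch, *Algebraic Number Theory*, Ch. VII §6, (6.9) and the definition of the conductor
after (6.11) (the conductor of `χ` mod `𝔪` is the smallest module of definition).
[cite: NeukirchANT1999, Ch. VII Prop. (6.9)] -/
theorem HeckeCharacter.not_isUnramifiedAt_ofDirichlet {f : ℕ} [NeZero f]
    {d₀ : DirichletCharacter ℂ f} (hprim : d₀.IsPrimitive) (q₀ : f.primeFactors) :
    ¬ (HeckeCharacter.ofDirichlet d₀).IsUnramifiedAt (Rat.placeOfFactor f q₀) := by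
  intro h
  have hp : (q₀ : ℕ).Prime := Nat.prime_of_mem_primeFactors q₀.2
  have hpf : (q₀ : ℕ) ∣ f := Nat.dvd_of_mem_primeFactors q₀.2
  have hf' : ordCompl[(q₀ : ℕ)] f ∣ f := Nat.ordCompl_dvd f q₀
  have hfac : d₀.FactorsThrough (ordCompl[(q₀ : ℕ)] f) := by
    rw [DirichletCharacter.factorsThrough_iff_ker_unitsMap hf']
    intro x hx
    rw [MonoidHom.mem_ker] at hx ⊢
    obtain ⟨U, hU1, hUx⟩ := Rat.exists_rayClassHom_localUnits_eq q₀ hx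
    have h1 := h.map_localUnits_eq_one U hU1
    rw [HeckeCharacter.ofDirichlet_apply, hUx, inv_eq_one] at h1
    exact h1
  have hdvd : d₀.conductor ∣ ordCompl[(q₀ : ℕ)] f :=
    DirichletCharacter.conductor_dvd_of_mem_conductorSet d₀ hfac
  rw [(DirichletCharacter.isPrimitive_def d₀).1 hprim] at hdvd
  have hlt : ordCompl[(q₀ : ℕ)] f < f := Nat.div_lt_self (NeZero.pos f)
    (Nat.one_lt_pow (Nat.Prime.factorization_pos_of_dvd hp (NeZero.ne f) hpf).ne' hp.one_lt)
  exact absurd (Nat.le_of_dvd (Nat.ordCompl_pos _ (NeZero.ne f)) hdvd) (not_le.2 hlt)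

/-- `ψ_1 = 1` for the trivial Dirichlet character mod `m`. [folklore] -/
theorem HeckeCharacter.ofDirichlet_one {m : ℕ} [NeZero m] :
    HeckeCharacter.ofDirichlet (1 : DirichletCharacter ℂ m) = 1 := by
  refine HeckeCharacter.ext fun x => ?_
  rw [HeckeCharacter.ofDirichlet_apply, HeckeCharacter.one_apply, inv_eq_one]
  exact Units.ext (by rw [MulChar.coe_toUnitHom, MulChar.one_apply_coe, Units.val_one])

/-- **Every finite-order Hecke character of `ℚ` is the Hecke character of a primitive Dirichlet
character** (its conductor): `ψ = ψ_{d₀}` with `d₀` primitive. From the tree's dictionary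
(`exists_dirichletCharacter_of_isFiniteOrder_holds`: some `d` mod `m` matches `ψ` at all `p ∤ m`)
with `d₀ = d.primitiveCharacter` (Mathlib), `ψ_{d₀}` matching `d` at `p ∤ m` as well, and the
uniqueness half of `HeckeCharacter.exists_of_dirichletCharacter_holds`.
Ref: Neukirch, *Algebraic Number Theory*, Ch. VII §6, Prop. (6.9), (6.12)–(6.14).
[cite: NeukirchANT1999, Ch. VII Prop. (6.9)] -/
theorem HeckeCharacter.exists_eq_ofDirichlet_isPrimitive (ψ : HeckeCharacter ℚ)
    (hψ : ψ.IsFiniteOrder) :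
    ∃ (f : ℕ) (_ : NeZero f) (d₀ : DirichletCharacter ℂ f),
      d₀.IsPrimitive ∧ ψ = HeckeCharacter.ofDirichlet d₀ := by
  obtain ⟨m, hm, d, hd⟩ := HeckeCharacter.exists_dirichletCharacter_of_isFiniteOrder_holds ψ hψ
  haveI : NeZero d.conductor := ⟨d.conductor_ne_zero⟩
  refine ⟨d.conductor, inferInstance, d.primitiveCharacter, d.primitiveCharacter_isPrimitive, ?_⟩
  obtain ⟨ψ₁, -, huniq⟩ := HeckeCharacter.exists_of_dirichletCharacter_holds d
  have h1 : ψ = ψ₁ := huniq ψ ⟨hψ, hd⟩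
  have h2 : HeckeCharacter.ofDirichlet d.primitiveCharacter = ψ₁ := by
    refine huniq _ ⟨HeckeCharacter.isFiniteOrder_ofDirichlet _, fun v hv => ?_⟩
    rw [Rat.natCast_mem_asIdeal_iff] at hv
    have hvf : ¬ natGenerator v ∣ d.conductor := fun h => hv (h.trans d.conductor_dvd_level)
    refine ⟨HeckeCharacter.isUnramifiedAt_ofDirichlet _ hvf, ?_⟩
    rw [HeckeCharacter.valueAtUniformizer_ofDirichlet _ hvf]
    have hu : IsUnit ((v.residueCard : ℕ) : ZMod m) := by
      rw [ZMod.isUnit_iff_coprime, Rat.residueCard_eq_natGenerator]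
      exact (Nat.Prime.coprime_iff_not_dvd (prime_natGenerator v)).2 hv
    conv_rhs => rw [← DirichletCharacter.changeLevel_primitiveCharacter d, ← hu.unit_spec,
      DirichletCharacter.changeLevel_eq_cast_of_dvd d.primitiveCharacter _ hu.unit, hu.unit_spec,
      ZMod.cast_natCast d.conductor_dvd_level]
  rw [h1, ← h2]

end Conductor

/-! ### Partial Hecke `L`-functions of `ℚ` are entire -/

section Entire

open Literature.NumberTheory.Automorphic

/-- **Partial `L`-functions of non-trivial finite-order Hecke characters of `ℚ` are entire.** For a
unitary Hecke character `ψ ≠ 1` of `ℚ` trivial on `ℝ_{>0}` (hence of finite order,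
`AutomorphicGRHOne.isFiniteOrder_of_map_posRealIdele`) and a finite set `S` of places off which `ψ`
is unramified, `L^S(s, ψ) = ∏'_{v ∉ S} (1 - ψ(ϖ_v) q_v^{-s})⁻¹` (`Re s > 1`) extends to an entire
function. Proof: `ψ = ψ_{d₀}` for a primitive `d₀` of conductor `f`
(`exists_eq_ofDirichlet_isPrimitive`); every `p ∣ f` lies under `S`
(`not_isUnramifiedAt_ofDirichlet`); so `L^S(s, ψ) = L(s, d₀,N)` on `Re s > 1`, `N = f ∏_{v ∈ S} p_v`
(`tprod_eulerFactor_eq_LSeries_mul_prod` with empty exceptional set), and `L(s, d₀,N)` is entire for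
`d₀,N ≠ 1` (Mathlib `DirichletCharacter.differentiable_LFunction`; `d₀ = 1` would force
`ψ = ψ_1 = 1`). In print: Dirichlet/Hecke, `L(s, χ)` entire for `χ ≠ 1`
(Neukirch VII (8.6) for `K = ℚ`; (2.13) for Dirichlet `L`-series). [cite: NeukirchANT1999, Ch. VII Cor. (8.6)] -/
theorem exists_entire_eq_partialHeckeL_rat (ψ : HeckeCharacter ℚ)
    (hA : ∀ t : ℝ≥0ˣ, ψ (posRealIdele ℚ t) = 1) (h1 : ψ ≠ 1)
    {S : Set (HeightOneSpectrum (𝓞 ℚ))} (hS : S.Finite) (hur : ∀ v ∉ S, ψ.IsUnramifiedAt v) :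
    ∃ g : ℂ → ℂ, Differentiable ℂ g ∧ ∀ s : ℂ, 1 < s.re →
      g s = ∏' v : {v : HeightOneSpectrum (𝓞 ℚ) // v ∉ S},
        (1 - ψ.valueAtUniformizer v.1 * ((v.1.residueCard : ℂ) ^ (-s)))⁻¹ := by
  classical
  have hfin : ψ.IsFiniteOrder :=
    Literature.NumberTheory.LFunctions.AutomorphicGRHOne.isFiniteOrder_of_map_posRealIdele ψ hA
  obtain ⟨f, hf, d₀, hprim, rfl⟩ := HeckeCharacter.exists_eq_ofDirichlet_isPrimitive ψ hfin
  -- the primes of the conductor lie under `S`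
  have hSf : ∀ v ∉ S, ¬ natGenerator v ∣ f := fun v hv hdvd => by
    obtain ⟨q, hq⟩ := Rat.exists_placeOfFactor_eq hdvd
    exact HeckeCharacter.not_isUnramifiedAt_ofDirichlet hprim q (hq ▸ hur v hv)
  have hd : ∀ v : HeightOneSpectrum (𝓞 ℚ), (f : 𝓞 ℚ) ∉ v.asIdeal →
      (HeckeCharacter.ofDirichlet d₀).IsUnramifiedAt v ∧
        (HeckeCharacter.ofDirichlet d₀).valueAtUniformizer v = d₀ (v.residueCard : ZMod f) := by
    intro v hv
    rw [Rat.natCast_mem_asIdeal_iff] at hv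
    exact ⟨HeckeCharacter.isUnramifiedAt_ofDirichlet d₀ hv,
      HeckeCharacter.valueAtUniformizer_ofDirichlet d₀ hv⟩
  -- the imprimitive character `d₀,N`, `N = f ∏_{v ∈ S} p_v`
  have hP0 : (∏ v ∈ hS.toFinset, natGenerator v) ≠ 0 :=
    Finset.prod_ne_zero_iff.2 fun v _ => (prime_natGenerator v).ne_zero
  haveI hN : NeZero (f * ∏ v ∈ hS.toFinset, natGenerator v) := ⟨mul_ne_zero (NeZero.ne f) hP0⟩
  have hd'1 : DirichletCharacter.changeLevel (dvd_mul_right f (∏ v ∈ hS.toFinset, natGenerator v))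
      d₀ ≠ 1 := by
    intro h
    rw [DirichletCharacter.changeLevel_eq_one_iff] at h
    rw [h, HeckeCharacter.ofDirichlet_one] at h1
    exact h1 rfl
  refine ⟨fun s => (DirichletCharacter.changeLevel (dvd_mul_right f
      (∏ v ∈ hS.toFinset, natGenerator v)) d₀).LFunction s,
    DirichletCharacter.differentiable_LFunction hd'1, fun s hs => ?_⟩
  have key := tprod_eulerFactor_eq_LSeries_mul_prod (HeckeCharacter.ofDirichlet d₀) d₀ hd hS
    Set.finite_empty (F := ∅) (fun v => ⟨fun h => h.elim, fun h => (hSf v h.1 h.2).elim⟩) hs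
  change (DirichletCharacter.changeLevel _ d₀).LFunction s = _
  rw [DirichletCharacter.LFunction_eq_LSeries _ hs, key, Set.Finite.toFinset_empty,
    Finset.prod_empty, mul_one]

end Entire

end Literature.NumberTheory.GaloisRepresentations

/-! ### Corollaire (i)(b) for `GL_1` over `ℚ` -/

namespace Literature.NumberTheory.Automorphic

open AdelicGroupData GaloisRepresentations

/-- **Mœglin–Waldspurger, Corollaire (i)(b), rank one over `ℚ`, unconditionally.** For cuspidal
automorphic representations `π, π'` of `GL_1(𝔸_ℚ)` in `L²_cusp(GL_1(ℚ) ℝ_{>0} \ GL_1(𝔸_ℚ))` with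
`π ≠ π̄'` (`π ≇ σ̃`) and honest Satake families `α`, `β` off a finite set `S` of places, the partial
Rankin–Selberg `L`-function `L^S(s, π × π') = L^S(s, χ_π χ_{π'})` extends to an entire function: the
named fact `MoeglinWaldspurger1989_partialPairL_entire_of_ne_conj` for `n = 1`, `K = ℚ`, by the
reduction to Hecke characters (`…_one_of_heckeCharacter`) and the entireness of the partial Dirichlet
`L`-functions (`exists_entire_eq_partialHeckeL_rat`). In print, condition (b) for `n = n' = 1` reads
`χ_π χ_{π'} ≠ |·|^t`, and `L(s, χ_π χ_{π'})` is Dirichlet's entire `L`-function.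
[cite: MoeglinWaldspurger1989, Appendice, Corollaire (i)(b), p. 667] -/
theorem MoeglinWaldspurger1989_partialPairL_entire_of_ne_conj_one_rat
    {μ : Measure (gl 1 ℚ).automorphicQuotient} [(gl 1 ℚ).IsAutomorphicMeasure μ] :
    MoeglinWaldspurger1989_partialPairL_entire_of_ne_conj (n := 1) (K := ℚ) (μ := μ) :=
  MoeglinWaldspurger1989_partialPairL_entire_of_ne_conj_one_of_heckeCharacter
    fun ψ _ hA h1 _ hS hur => exists_entire_eq_partialHeckeL_rat ψ hA h1 hS hur

end Literature.NumberTheory.Automorphic
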